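import Mathlib
import HarnessLib
import Summits.Ventures.LatticeQCDFlow.StatementSectors
import Summits.Ventures.LatticeQCDFlow.Scaling.U1CrossCutFloor

/-!
# Venture statement — LatticeQCDFlow — DRAFT, Part S14: THE CROSS-CUT CORRELATOR FLOOR (U′) AT
# STRONG COUPLING FOR `U(1)`, `R = 0` — hypothesis (U′) of the volume law, UNCONDITIONAL
# (theory-2 row 29 / lean-1 row 30)

HONEST FRAMING: exact (Metropolis-corrected) sampling algorithms for lattice gauge theory;
figures of merit are autocorrelation/cost numbers at stated couplings and volumes; no
continuum-physics claim.

This file CONTINUES `StatementSectors.lean` (Part S9–S13) of the venture's `Statement.lean` DRAFT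
(review-queued; it STAYS A DRAFT until the operator adopts it).  It is the ONE pre-authorised
S-side Part after the S13 freeze (LEAD LINES 229 / 230 / 234 (iv) / 237: "S14 for (LC) … ONE Part
citing `crossCutCorrelatorFloor_u1` (t = 1, U(1)) with its audit row").  The `Prop` is a typed
statement over the landed substrate with its `_holds` discharge next to it, and
`TheoryStatementS14 := TheoryStatementS13 ∧ S14` is PROVED.

* **S14 ((LC) AT SEPARATION ONE AND (U′) AT STRONG COUPLING FOR COMPACT `U(1)`, `R = 0` — lean-1
  GEN-8, `Scaling/U1LeadingCoefficient.lean` + `Scaling/U1CrossCutFloor.lean`, on theory2's items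
  120 / 121 `Scaling/TruncatedCorrelatorFloor.lean` / `Scaling/CrossCutFloorOfLeadingCoeff.lean`)**
  — compact `U(1)` (`G = Circle`, `ρ = u1Rep`) with the Wilson action on the torus `(ℤ/L)^d`, every
  `d`, coordinate directions `i < j` and `a ∉ {i, j}` (so `d ≥ 3`), `P = Re tr u1Rep(U_{0,ij})` the
  plaquette at the origin and `P′` its translate by `e_a`:
  (a) for every torus side `L ≥ 3` the truncated (connected) correlator, as a function of complex
  `β`, satisfies `torusTruncC u1Rep L P P e_a β − β⁴/32 = O(β⁵)` at `β = 0` — the leading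
  strong-coupling coefficient of the plaquette–plaquette correlator one lattice unit across the cut
  is `1/32`, the same in every volume;
  (b) there is ONE `β₀ > 0` such that for every real `β ≠ 0` with `|β| ≤ β₀` the venture's filed
  hypothesis `Conjectures.CrossCutCorrelatorFloor d 1 Circle u1Rep β 0 i j a` holds: some `δ > 0`
  bounds the connected correlator of the two parallel plaquettes from below on every torus of side
  `≥ L₀`, for some `L₀`, at every site `x` (the proof's witnesses: `δ = |β|⁴/64`, `L₀ = 3`) —
  hypothesis (U′) of the exponential volume law for fixed-receptive-field flows
  (`Barriers.VolumeScalingOfTraining`, `Theory2.BlockDefectVolumeLaw`), uniformly in the volume,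
  with NO physics input, at strong coupling;
  (c) the same for the repaired item `Conjectures.CrossCutCorrelatorFloorR` (T2-AD).
  PROVED: `Theory2.Lattice.U1Torus.torusTruncC_leadingCoeff_u1_one`, `crossCutCorrelatorFloor_u1`,
  `crossCutCorrelatorFloorR_u1` (`Scaling/U1CrossCutFloor.lean`).

What is NOT claimed: general separation `R ≥ 1` (the `4(2R+1)`-tube census (MI) is lean-1's next
K7 item), `SU(N)`, any `β` beyond the unspecified `β₀` of (b)/(c) (intermediate coupling is the
open uniformity-in-`L` content of (U′)), the size of `β₀`, and every continuum statement.  Nothing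
numerical is asserted; no `sorry`; the only new `def`s are the two `Prop`s of record.
-/

noncomputable section

open MeasureTheory Filter Topology Asymptotics
open Literature.MathematicalPhysics.QuantumFieldTheory
open Literature.MathematicalPhysics.QuantumLattice (u1Rep plaquetteObs)

namespace Summit.Ventures.LatticeQCDFlow

/-! ### Part S, appended — S14: (LC) at separation one and (U′) at strong coupling, `U(1)`, `R = 0`
(lean-1 GEN-8, 2026-08-22) -/

/-- **S14 (THE CROSS-CUT PLAQUETTE–PLAQUETTE CORRELATOR OF COMPACT `U(1)` ONE LATTICE UNIT APART
HAS LEADING COEFFICIENT `1/32` IN EVERY VOLUME AND IS BOUNDED BELOW, UNIFORMLY IN ALL LARGE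
VOLUMES, FOR EVERY SMALL `β ≠ 0` — hypothesis (U′) of the volume law at strong coupling, `R = 0`).**
For every `d`, `i < j`, `a ≠ i`, `a ≠ j`: (a) for every `L ≥ 2`,
`torusTruncC u1Rep (L+1) P P e_a β − β⁴/32 = O(β⁵)` at `β = 0` (`P = plaquetteObs u1Rep 0 i j`);
(b) `∃ β₀ > 0, ∀ β ≠ 0, |β| ≤ β₀ → Conjectures.CrossCutCorrelatorFloor d 1 Circle u1Rep β 0 i j a`;
(c) the same with `Conjectures.CrossCutCorrelatorFloorR`.  PROVED:
`Theory2.Lattice.U1Torus.torusTruncC_leadingCoeff_u1_one` / `crossCutCorrelatorFloor_u1` /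
`crossCutCorrelatorFloorR_u1` (`Scaling/U1CrossCutFloor.lean`, lean-1 GEN-8). -/
def S14_U1CrossCutFloorStrongCoupling : Prop :=
  ∀ (d : ℕ) (i j a : Fin d), i < j → a ≠ i → a ≠ j →
    (∀ L : ℕ, 2 ≤ L →
      (fun β : ℂ => Theory2.torusTruncC u1Rep (L + 1) (plaquetteObs u1Rep 0 i j)
          (plaquetteObs u1Rep 0 i j) (Pi.single a 1) β - (((32 : ℝ)⁻¹ : ℝ) : ℂ) * β ^ 4)
        =O[𝓝 (0 : ℂ)] fun β => β ^ (4 + 1)) ∧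
    (∃ β₀ : ℝ, 0 < β₀ ∧ ∀ β : ℝ, β ≠ 0 → |β| ≤ β₀ →
      Conjectures.CrossCutCorrelatorFloor d 1 Circle u1Rep β 0 i j a) ∧
    (∃ β₀ : ℝ, 0 < β₀ ∧ ∀ β : ℝ, β ≠ 0 → |β| ≤ β₀ →
      Conjectures.CrossCutCorrelatorFloorR d 1 Circle u1Rep β 0 i j a)

/-- S14 holds (`U1Torus.torusTruncC_leadingCoeff_u1_one`, `U1Torus.crossCutCorrelatorFloor_u1`,
`U1Torus.crossCutCorrelatorFloorR_u1`). -/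
theorem S14_U1CrossCutFloorStrongCoupling_holds : S14_U1CrossCutFloorStrongCoupling :=
  fun _ _ _ _ hij hai haj =>
    ⟨fun L hL => Theory2.Lattice.U1Torus.torusTruncC_leadingCoeff_u1_one hij hai haj L hL,
      Theory2.Lattice.U1Torus.crossCutCorrelatorFloor_u1 hij hai haj,
      Theory2.Lattice.U1Torus.crossCutCorrelatorFloorR_u1 hij hai haj⟩

/-- **The theory conjunction of record, extended by the strong-coupling `U(1)` cross-cut floor**:
`TheoryStatementS14 := TheoryStatementS13 ∧ S14`.  All conjuncts are theorems in the tree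
(`TheoryStatementS14_holds`).  DRAFT until the operator adopts it; nothing numerical is asserted. -/
def TheoryStatementS14 : Prop :=
  TheoryStatementS13 ∧ S14_U1CrossCutFloorStrongCoupling

/-- The extended theory conjunction holds. -/
theorem TheoryStatementS14_holds : TheoryStatementS14 :=
  ⟨TheoryStatementS13_holds, S14_U1CrossCutFloorStrongCoupling_holds⟩

end Summit.Ventures.LatticeQCDFlow

end
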